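import Summits.QuantumFields.BalabanUV.T4Continuum.Spine.NE7.QLaBlockAvgTwoLevel

/-!
# Spine/NE7/QLaBlockAvgTwoLevelFramed — the correction factor, the frames and the FRAMED TWO-LEVEL AVERAGE of [Balaban1987RG1] (0.12)
# (`blockAvg₂ federbushSU expMeanLogSU`) TO SECOND ORDER about the flat configuration, per coarse bond

Cell `pub-balaban-gaps` (YM blitz Y1, track G2, seat `ne7`, generation 8); text of record `run/shared/lean/pub/pub-balaban-gaps/ne/NE7.md` v8,
census row R55.  Sequel of `QLaBlockAvgTwoLevel` (indices, linear parts, the inner factors and the loop variable of (0.12) to second order):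
here the OUTER small-loop average (`corr₂`, on its small-field domain `Small₂` — inner families admissible for Federbush's mean, loop
variables within `δ_N`), the frames `λ₂` over `(x, Γ)`, and the four-factor framed average `F₂(V)(c) = λ₂(c₋)⁻¹·corr₂(c)·U(c)·λ₂(c₊)`:
`norm_framed₂_sub_one_sub_le` (‖F₂(V)(c) − 1 − segMeanLin₂(c)‖ ≤ 3354·|S_d|·ℓρ·rem₂(c)), `dist1_framed₂_le`, `dist1_framed₂_le_sup` (≤ 71·|S_d|·ℓρ).

HONEST FRAMING.  Elementary one-point second-order bookkeeping on OUR sup-ball domains (flat reference only); NOT NE1a-STEP; nothing of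
Bałaban's Props 3–5 or of (1.100).  (QL-a) NOT IN PRINT; NE7 NOT proved; spine 0∕9; fixed finite T⁴ — NOT ℝ⁴, NOT infinite volume, NOT a
mass gap, NOT Clay.
-/

noncomputable section

open Finset
open scoped BigOperators Matrix Matrix.Norms.L2Operator

namespace Summit.QuantumFields.BalabanUV.T4Continuum.Spine.NE7

open Literature.MathematicalPhysics.QuantumFieldTheory.Balaban1983to89
open Literature.MathematicalPhysics.QuantumFieldTheory.Balaban1983to89.T4Continuum
open Literature.MathematicalPhysics.QuantumFieldTheory.Balaban1983to89.T4AvgSensitivity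
open Literature.MathematicalPhysics.QuantumFieldTheory.Balaban1983to89.T4AvgDerivBound
open Literature.MathematicalPhysics.QuantumFieldTheory.Balaban1983to89.BlockAveraging (Idx off loopHol blockOf_src_of_mem_walk)
open Literature.MathematicalPhysics.QuantumFieldTheory.Balaban1983to89.BlockAveragingTwoLevel (Pt stairHol cVar cVarRev seg loopHol₂
  Small₂ corr₂ avgFun₂ blockAvg₂ blockAvg₂_avg)
open Literature.MathematicalPhysics.QuantumFieldTheory.Balaban1983to89.AveragingRT (axialAvg)
open ExpMeanLog FederbushMean

section SUN

variable {n : Type*} [Fintype n] [DecidableEq n] [Nonempty n]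
variable {P : Params} {j : ℕ}

/-! ## §5 The correction factor of (0.12) to second order -/

/-- THE MEAN REMAINDER MASS of the loop variables at `c`. [folklore] -/
def loopRemMean (V : GaugeField P j (Matrix.specialUnitaryGroup n ℂ)) (c : PBond P (j + 1)) : ℝ :=
  (Fintype.card (Pt P) : ℝ)⁻¹ * ∑ r : Pt P, loopRem₂ V c r

/-- The mean remainder mass is non-negative and at most `4|S_d|ℓρ`. [folklore] -/
theorem loopRemMean_bounds (V : GaugeField P j (Matrix.specialUnitaryGroup n ℂ)) {ρ : ℝ} (hρ : 0 ≤ ρ) (hV : ∀ b, dist1 (V b) ≤ ρ)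
    (c : PBond P (j + 1)) : 0 ≤ loopRemMean V c ∧ loopRemMean V c ≤ 4 * Dn P * (ell P * ρ) := by
  have hD := one_le_Dn P
  have hη0 : 0 ≤ ell P * ρ := by positivity
  refine ⟨mul_nonneg (inv_nonneg.mpr (Nat.cast_nonneg _)) (Finset.sum_nonneg fun r _ => loopRem₂_nonneg V c r),
    mean_le_of_le fun r => ?_⟩
  have h1 := permMass_le V hρ hV c.src r
  have h2 : segMass₁ V c r ≤ ell P * ρ := walkMass_ax_le V hρ hV _ _
  have h3 := permMass_le V hρ hV c.tgt r
  have h4 : axMass V c ≤ ell P * ρ := walkMass_ax_le V hρ hV _ _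
  unfold loopRem₂ Dn at *
  nlinarith

/-- THE CORRECTION FACTOR OF (0.12) IS ON ITS SMALL-FIELD DOMAIN: the inner families are admissible for `M` (pairwise `≤ 2ℓρ < δ_Fed`)
and every loop variable is within `12|S_d|ℓρ < δ_N` of the identity, so `corr₂ = E(loop family)`. [cite: Balaban1987RG1, (0.12) p.254] -/
theorem corr₂_eq_avg (V : GaugeField P j (Matrix.specialUnitaryGroup n ℂ)) {ρ : ℝ} (hρ : 0 ≤ ρ) (hV : ∀ b, dist1 (V b) ≤ ρ)
    (hF : 2 * (ell P * ρ) < deltaFed n) (hδ : 12 * Dn P * (ell P * ρ) < deltaSU n) (c : PBond P (j + 1)) :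
    corr₂ (federbushSU (n := n)) (expMeanLogSU (n := n)) V c = (expMeanLogSU (n := n)).avg (loopHol₂ (federbushSU (n := n)) V c) := by
  have hadm : ∀ (y : Site P (j + 1)) (r : Pt P), (federbushSU (n := n)).Adm (stairHol V y (off r)) := fun y r σ σ' => by
    have h1 : dist1 (stairHol V y (off r) σ) ≤ ell P * ρ := (dist1_holAt_le_walkMass V _).trans (walkMass_stair_le V hρ hV y ⟨r, σ, 1⟩)
    have h2 : dist1 (stairHol V y (off r) σ') ≤ ell P * ρ := (dist1_holAt_le_walkMass V _).trans (walkMass_stair_le V hρ hV y ⟨r, σ', 1⟩)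
    calc dist1 (stairHol V y (off r) σ * (stairHol V y (off r) σ')⁻¹)
        ≤ dist1 (stairHol V y (off r) σ) + dist1 (stairHol V y (off r) σ')⁻¹ := GaugeGroup.dist1_mul_le _ _
      _ ≤ ell P * ρ + ell P * ρ := by rw [GaugeGroup.dist1_inv]; exact add_le_add h1 h2
      _ < deltaFed n := by linarith
  have hS : Small₂ (federbushSU (n := n)) (expMeanLogSU (n := n)) V c := by
    refine ⟨fun r => hadm c.src r, fun r => hadm c.tgt r, fun r => ?_⟩
    have h := (loopHol₂_estimates V hρ hV hF c r).2
    have hb := (loopRemMean_bounds V hρ hV c)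
    have h1 := permMass_le V hρ hV c.src r
    have h2 : segMass₁ V c r ≤ ell P * ρ := walkMass_ax_le V hρ hV _ _
    have h3 := permMass_le V hρ hV c.tgt r
    have h4 : axMass V c ≤ ell P * ρ := walkMass_ax_le V hρ hV _ _
    have hD := one_le_Dn P
    have hη0 : 0 ≤ ell P * ρ := by positivity
    have : loopRem₂ V c r ≤ 4 * Dn P * (ell P * ρ) := by unfold loopRem₂ Dn at *; nlinarith
    show dist1 (loopHol₂ (federbushSU (n := n)) V c r) < deltaSU n
    linarith
  unfold corr₂
  rw [if_pos hS]

/-- **THE CORRECTION FACTOR OF (0.12) TO SECOND ORDER**: `‖corr₂(c) − 1 − (stairMeanLin₂(c₋) + segMeanLin₂(c) − stairMeanLin₂(c₊) − axLin(c))‖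
≤ 654·|S_d|·ℓρ·loopRemMean(c)` and `‖corr₂(c) − 1‖ ≤ 15·loopRemMean(c)`. [folklore] -/
theorem corr₂_estimates (V : GaugeField P j (Matrix.specialUnitaryGroup n ℂ)) {ρ : ℝ} (hρ : 0 ≤ ρ) (hV : ∀ b, dist1 (V b) ≤ ρ)
    (hF : 2 * (ell P * ρ) < deltaFed n) (hδ : 12 * Dn P * (ell P * ρ) < deltaSU n) (h2 : 12 * Dn P * (ell P * ρ) ≤ 1 / 2)
    (c : PBond P (j + 1)) :
    ‖((corr₂ (federbushSU (n := n)) (expMeanLogSU (n := n)) V c : Matrix.specialUnitaryGroup n ℂ) : MatA n) - 1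
        - (stairMeanLin₂ V c.src + segMeanLin₂ V c - stairMeanLin₂ V c.tgt - axLin V c)‖
        ≤ 654 * Dn P * (ell P * ρ) * loopRemMean V c ∧
      ‖((corr₂ (federbushSU (n := n)) (expMeanLogSU (n := n)) V c : Matrix.specialUnitaryGroup n ℂ) : MatA n) - 1‖
        ≤ 15 * loopRemMean V c := by
  rw [corr₂_eq_avg V hρ hV hF hδ c, ← mean_loopLin₂ V c]
  set η : ℝ := ell P * ρ with hη
  have hη0 : 0 ≤ η := by positivity
  have hD := one_le_Dn P
  set W := loopHol₂ (federbushSU (n := n)) V c with hWdef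
  have hW3 : ∀ r, dist1 (W r) ≤ 3 * loopRem₂ V c r := fun r => (loopHol₂_estimates V hρ hV hF c r).2
  have hRem : ∀ r, loopRem₂ V c r ≤ 4 * Dn P * η := fun r => by
    have h1 := permMass_le V hρ hV c.src r
    have h2 : segMass₁ V c r ≤ ell P * ρ := walkMass_ax_le V hρ hV _ _
    have h3 := permMass_le V hρ hV c.tgt r
    have h4 : axMass V c ≤ ell P * ρ := walkMass_ax_le V hρ hV _ _
    unfold loopRem₂ Dn at *; nlinarith
  have hW : ∀ r, dist1 (W r) ≤ 12 * Dn P * η := fun r => (hW3 r).trans (by nlinarith [hRem r])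
  have hc0 : 0 ≤ (Fintype.card (Pt P) : ℝ)⁻¹ := inv_nonneg.mpr (Nat.cast_nonneg _)
  have hmean : (Fintype.card (Pt P) : ℝ)⁻¹ * ∑ r, dist1 (W r) ≤ 3 * loopRemMean V c := by
    have hs : ∑ r, dist1 (W r) ≤ ∑ r, 3 * loopRem₂ V c r := Finset.sum_le_sum fun r _ => hW3 r
    rw [← Finset.mul_sum] at hs
    calc (Fintype.card (Pt P) : ℝ)⁻¹ * ∑ r, dist1 (W r) ≤ (Fintype.card (Pt P) : ℝ)⁻¹ * (3 * ∑ r, loopRem₂ V c r) :=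
          mul_le_mul_of_nonneg_left hs hc0
      _ = 3 * loopRemMean V c := by rw [loopRemMean]; ring
  have hlRM0 := (loopRemMean_bounds V hρ hV c).1
  set Cm : MatA n := (((expMeanLogSU (n := n)).avg W : Matrix.specialUnitaryGroup n ℂ) : MatA n) with hCm
  set Mn : MatA n := ((Fintype.card (Pt P) : ℂ))⁻¹ • ∑ r, (((W r : Matrix.specialUnitaryGroup n ℂ) : MatA n) - 1) with hMn
  set Ln : MatA n := ((Fintype.card (Pt P) : ℂ))⁻¹ • ∑ r, loopLin₂ V c r with hLn
  have h8 : ‖Cm - 1 - Mn‖ ≤ 8 * (12 * Dn P * η) * ((Fintype.card (Pt P) : ℝ)⁻¹ * ∑ r, dist1 (W r)) :=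
    norm_avg_sub_one_sub_mean_le W hδ h2 hW
  have h5 : ‖Cm - 1‖ ≤ 5 * ((Fintype.card (Pt P) : ℝ)⁻¹ * ∑ r, dist1 (W r)) := norm_avg_sub_one_le W hδ h2 hW
  refine ⟨?_, h5.trans (by linarith)⟩
  have hlin : ‖Mn - Ln‖ ≤ 366 * Dn P * η * loopRemMean V c := by
    rw [hMn, hLn, ← smul_sub, ← Finset.sum_sub_distrib]
    refine (norm_mean_le _).trans ?_
    have hs : ∑ r, ‖(((W r : Matrix.specialUnitaryGroup n ℂ) : MatA n) - 1) - loopLin₂ V c r‖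
        ≤ ∑ r, 366 * Dn P * η * loopRem₂ V c r := Finset.sum_le_sum fun r _ => (loopHol₂_estimates V hρ hV hF c r).1
    rw [← Finset.mul_sum] at hs
    calc (Fintype.card (Pt P) : ℝ)⁻¹ * ∑ r, ‖(((W r : Matrix.specialUnitaryGroup n ℂ) : MatA n) - 1) - loopLin₂ V c r‖
        ≤ (Fintype.card (Pt P) : ℝ)⁻¹ * (366 * Dn P * η * ∑ r, loopRem₂ V c r) := mul_le_mul_of_nonneg_left hs hc0
      _ = 366 * Dn P * η * loopRemMean V c := by rw [loopRemMean]; ring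
  have hsplit : Cm - 1 - Ln = (Cm - 1 - Mn) + (Mn - Ln) := by abel
  rw [hsplit]
  refine (norm_add_le _ _).trans ?_
  have h96 : 8 * (12 * Dn P * η) * ((Fintype.card (Pt P) : ℝ)⁻¹ * ∑ r, dist1 (W r))
      ≤ 8 * (12 * Dn P * η) * (3 * loopRemMean V c) := mul_le_mul_of_nonneg_left hmean (by positivity)
  have h8' : ‖Cm - 1 - Mn‖ ≤ 288 * Dn P * η * loopRemMean V c := h8.trans (h96.trans (by ring_nf; exact le_rfl))
  linarith

/-! ## §6 The frames and the framed two-level average to second order -/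

/-- THE MEAN STAIRCASE MASS over `(x, Γ)` at `y`. [folklore] -/
def stairMass₂ (V : GaugeField P j (Matrix.specialUnitaryGroup n ℂ)) (y : Site P (j + 1)) : ℝ :=
  (Fintype.card (PI P) : ℝ)⁻¹ * ∑ p : PI P, walkMass V (walk (emb y) (stairWord p.2 (off p.1)))

/-- THE FRAME OF THE TWO-LEVEL ANALYSIS TO SECOND ORDER: `‖λ₂ − 1 − stairMeanLin₂‖ ≤ 9ℓρ·stairMass₂`, `‖λ₂ − 1‖ ≤ 5·stairMass₂`. [folklore] -/
theorem frame₂_estimates (V : GaugeField P j (Matrix.specialUnitaryGroup n ℂ)) {ρ : ℝ} (hρ : 0 ≤ ρ) (hV : ∀ b, dist1 (V b) ≤ ρ)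
    (hδ : ell P * ρ < deltaSU n) (h2 : ell P * ρ ≤ 1 / 2) (y : Site P (j + 1)) :
    ‖((frame₂ V y : Matrix.specialUnitaryGroup n ℂ) : MatA n) - 1 - stairMeanLin₂ V y‖ ≤ 9 * (ell P * ρ) * stairMass₂ V y ∧
      ‖((frame₂ V y : Matrix.specialUnitaryGroup n ℂ) : MatA n) - 1‖ ≤ 5 * stairMass₂ V y :=
  avg_hol_estimates V (fun p : PI P => walk (emb y) (stairWord p.2 (off p.1))) (fun p => walkMass_stair_le V hρ hV y ⟨p.1, p.2, 1⟩) hδ h2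

/-- THE INVERSE FRAME TO SECOND ORDER: `‖λ₂⁻¹ − 1 + stairMeanLin₂‖ ≤ 34ℓρ·stairMass₂`. [folklore] -/
theorem frame₂Inv_estimate (V : GaugeField P j (Matrix.specialUnitaryGroup n ℂ)) {ρ : ℝ} (hρ : 0 ≤ ρ) (hV : ∀ b, dist1 (V b) ≤ ρ)
    (hδ : ell P * ρ < deltaSU n) (h2 : ell P * ρ ≤ 1 / 2) (y : Site P (j + 1)) :
    ‖(((frame₂ V y)⁻¹ : Matrix.specialUnitaryGroup n ℂ) : MatA n) - 1 - (-stairMeanLin₂ V y)‖ ≤ 34 * (ell P * ρ) * stairMass₂ V y := by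
  obtain ⟨h9, h5⟩ := frame₂_estimates V hρ hV hδ h2 y
  have hsq := norm_coe_inv_sub_one_add_le (frame₂ V y)
  have hsm : stairMass₂ V y ≤ ell P * ρ := mean_le_of_le fun p => walkMass_stair_le V hρ hV y ⟨p.1, p.2, 1⟩
  have hsm0 : 0 ≤ stairMass₂ V y := mul_nonneg (inv_nonneg.mpr (Nat.cast_nonneg _)) (Finset.sum_nonneg fun p _ => walkMass_nonneg V _)
  have hsplit : (((frame₂ V y)⁻¹ : Matrix.specialUnitaryGroup n ℂ) : MatA n) - 1 - (-stairMeanLin₂ V y)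
      = ((((frame₂ V y)⁻¹ : Matrix.specialUnitaryGroup n ℂ) : MatA n) - 1 + (((frame₂ V y : Matrix.specialUnitaryGroup n ℂ) : MatA n) - 1))
        - ((((frame₂ V y : Matrix.specialUnitaryGroup n ℂ)) : MatA n) - 1 - stairMeanLin₂ V y) := by abel
  rw [hsplit]
  refine (norm_sub_le _ _).trans ?_
  have hsq' : ‖((frame₂ V y : Matrix.specialUnitaryGroup n ℂ) : MatA n) - 1‖ ^ 2 ≤ (5 * stairMass₂ V y) * (5 * (ell P * ρ)) := by
    rw [pow_two]; exact mul_le_mul h5 (h5.trans (by linarith)) (norm_nonneg _) (by linarith)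
  nlinarith

/-- THE REMAINDER MASS of the two-level framed average at `c`. [folklore] -/
def rem₂ (V : GaugeField P j (Matrix.specialUnitaryGroup n ℂ)) (c : PBond P (j + 1)) : ℝ :=
  stairMass₂ V c.src + loopRemMean V c + axMass V c + stairMass₂ V c.tgt

set_option maxHeartbeats 400000 in
/-- **THE FRAMED TWO-LEVEL AVERAGE TO SECOND ORDER** (per coarse bond): `‖F₂(V)(c) − 1 − segMeanLin₂(V,c)‖ ≤ 3354·|S_d|·ℓρ·rem₂(V,c)`.
[folklore] -/
theorem norm_framed₂_sub_one_sub_le (hj : j + 1 ≤ P.m + P.K) (V : GaugeField P j (Matrix.specialUnitaryGroup n ℂ)) {ρ : ℝ}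
    (hρ : 0 ≤ ρ) (hV : ∀ b, dist1 (V b) ≤ ρ) (hF : 2 * (ell P * ρ) < deltaFed n) (hδ : 12 * Dn P * (ell P * ρ) < deltaSU n)
    (h2 : 12 * Dn P * (ell P * ρ) ≤ 1 / 2) (c : PBond P (j + 1)) :
    ‖((framed₂ V c : Matrix.specialUnitaryGroup n ℂ) : MatA n) - 1 - segMeanLin₂ V c‖ ≤ 3354 * Dn P * (ell P * ρ) * rem₂ V c := by
  set η : ℝ := ell P * ρ with hη
  have hη0 : 0 ≤ η := by positivity
  have hD := one_le_Dn P
  have hδ1 : η < deltaSU n := lt_of_le_of_lt (by nlinarith) hδ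
  have h21 : η ≤ 1 / 2 := (show η ≤ 12 * Dn P * η by nlinarith).trans h2
  have _ := hj
  obtain ⟨_, f1'⟩ := frame₂_estimates V hρ hV hδ1 h21 c.src
  have d1 := frame₂Inv_estimate V hρ hV hδ1 h21 c.src
  obtain ⟨d2, f2⟩ := corr₂_estimates V hρ hV hF hδ h2 c
  obtain ⟨d3, f3⟩ := ax_estimates V hρ hV c
  obtain ⟨d4, f4⟩ := frame₂_estimates V hρ hV hδ1 h21 c.tgt
  have f1 : ‖(((frame₂ V c.src)⁻¹ : Matrix.specialUnitaryGroup n ℂ) : MatA n) - 1‖ ≤ 5 * stairMass₂ V c.src := by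
    rw [norm_coe_inv_sub_one]; exact f1'
  have hs1 : stairMass₂ V c.src ≤ η := mean_le_of_le fun p => walkMass_stair_le V hρ hV _ ⟨p.1, p.2, 1⟩
  obtain ⟨hp2, hs2⟩ := loopRemMean_bounds V hρ hV c
  have hs3 : axMass V c ≤ η := walkMass_ax_le V hρ hV _ _
  have hs4 : stairMass₂ V c.tgt ≤ η := mean_le_of_le fun p => walkMass_stair_le V hρ hV _ ⟨p.1, p.2, 1⟩
  have hp1 : 0 ≤ stairMass₂ V c.src := mul_nonneg (inv_nonneg.mpr (Nat.cast_nonneg _)) (Finset.sum_nonneg fun p _ => walkMass_nonneg V _)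
  have hp3 : 0 ≤ axMass V c := walkMass_nonneg V _
  have hp4 : 0 ≤ stairMass₂ V c.tgt := mul_nonneg (inv_nonneg.mpr (Nat.cast_nonneg _)) (Finset.sum_nonneg fun p _ => walkMass_nonneg V _)
  have hDη : η ≤ Dn P * η := by nlinarith
  have key := norm_prod4_sub_one_sub_le_lin (Φ := 60 * (Dn P * η))
    (le_of_eq (norm_coe_eq_one _)) (le_of_eq (norm_coe_eq_one _)) f1 f2 f3 f4
    (by nlinarith) (by nlinarith) (by nlinarith) (by nlinarith) d1 d2 d3 d4
  have hprod : ((framed₂ V c : Matrix.specialUnitaryGroup n ℂ) : MatA n)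
      = (((frame₂ V c.src)⁻¹ : Matrix.specialUnitaryGroup n ℂ) : MatA n)
        * ((corr₂ (federbushSU (n := n)) (expMeanLogSU (n := n)) V c : Matrix.specialUnitaryGroup n ℂ) : MatA n)
        * ((axialAvg V c : Matrix.specialUnitaryGroup n ℂ) : MatA n) * ((frame₂ V c.tgt : Matrix.specialUnitaryGroup n ℂ) : MatA n) := by
    rw [framed₂_apply]; simp only [Submonoid.coe_mul]
  have hlin : -stairMeanLin₂ V c.src + (stairMeanLin₂ V c.src + segMeanLin₂ V c - stairMeanLin₂ V c.tgt - axLin V c) + axLin V c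
      + stairMeanLin₂ V c.tgt = segMeanLin₂ V c := by abel
  rw [hprod, ← hlin]
  refine key.trans ?_
  rw [rem₂]
  have hDη0 : 0 ≤ Dn P * η := by positivity
  nlinarith [mul_nonneg hDη0 hp1, mul_nonneg hDη0 hp2, mul_nonneg hDη0 hp3, mul_nonneg hDη0 hp4,
    mul_nonneg hη0 hp1, mul_nonneg hη0 hp2, mul_nonneg hη0 hp3, mul_nonneg hη0 hp4]

/-- The first-order term is bounded by the mean transported-bond mass (two-level indexing). [folklore] -/
theorem norm_segMeanLin₂_le (V : GaugeField P j (Matrix.specialUnitaryGroup n ℂ)) (c : PBond P (j + 1)) :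
    ‖segMeanLin₂ V c‖ ≤ (Fintype.card (Pt P) : ℝ)⁻¹ * ∑ r : Pt P, segMass₁ V c r :=
  (norm_mean_le _).trans (mul_le_mul_of_nonneg_left (Finset.sum_le_sum fun _ _ => norm_walkLin_le V _) (inv_nonneg.mpr (Nat.cast_nonneg _)))

/-- **PER-BOND DEVIATION**: `dist1 F₂(V)(c) ≤ |Pt|⁻¹Σ_r segMass₁(c,r) + 3354·|S_d|·ℓρ·rem₂(c)`. [folklore] -/
theorem dist1_framed₂_le (hj : j + 1 ≤ P.m + P.K) (V : GaugeField P j (Matrix.specialUnitaryGroup n ℂ)) {ρ : ℝ}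
    (hρ : 0 ≤ ρ) (hV : ∀ b, dist1 (V b) ≤ ρ) (hF : 2 * (ell P * ρ) < deltaFed n) (hδ : 12 * Dn P * (ell P * ρ) < deltaSU n)
    (h2 : 12 * Dn P * (ell P * ρ) ≤ 1 / 2) (c : PBond P (j + 1)) :
    dist1 (framed₂ V c) ≤ (Fintype.card (Pt P) : ℝ)⁻¹ * ∑ r : Pt P, segMass₁ V c r + 3354 * Dn P * (ell P * ρ) * rem₂ V c := by
  rw [dist1_eq_norm]
  have h := norm_framed₂_sub_one_sub_le hj V hρ hV hF hδ h2 c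
  have hsplit : ((framed₂ V c : Matrix.specialUnitaryGroup n ℂ) : MatA n) - 1
      = (((framed₂ V c : Matrix.specialUnitaryGroup n ℂ) : MatA n) - 1 - segMeanLin₂ V c) + segMeanLin₂ V c := by abel
  rw [hsplit]
  exact (norm_add_le _ _).trans (by linarith [norm_segMeanLin₂_le V c])

/-- **SUP BOUND**: `dist1 F₂(V)(c) ≤ 71·|S_d|·ℓρ`. [folklore] -/
theorem dist1_framed₂_le_sup (V : GaugeField P j (Matrix.specialUnitaryGroup n ℂ)) {ρ : ℝ}
    (hρ : 0 ≤ ρ) (hV : ∀ b, dist1 (V b) ≤ ρ) (hF : 2 * (ell P * ρ) < deltaFed n) (hδ : 12 * Dn P * (ell P * ρ) < deltaSU n)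
    (h2 : 12 * Dn P * (ell P * ρ) ≤ 1 / 2) (c : PBond P (j + 1)) :
    dist1 (framed₂ V c) ≤ 71 * Dn P * (ell P * ρ) := by
  set η : ℝ := ell P * ρ with hη
  have hη0 : 0 ≤ η := by positivity
  have hD := one_le_Dn P
  have hδ1 : η < deltaSU n := lt_of_le_of_lt (by nlinarith) hδ
  have h21 : η ≤ 1 / 2 := (show η ≤ 12 * Dn P * η by nlinarith).trans h2
  have hs1 : stairMass₂ V c.src ≤ η := mean_le_of_le fun p => walkMass_stair_le V hρ hV _ ⟨p.1, p.2, 1⟩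
  have hs4 : stairMass₂ V c.tgt ≤ η := mean_le_of_le fun p => walkMass_stair_le V hρ hV _ ⟨p.1, p.2, 1⟩
  obtain ⟨_, hs2⟩ := loopRemMean_bounds V hρ hV c
  have f1 : dist1 (frame₂ V c.src)⁻¹ ≤ 5 * η := by
    rw [GaugeGroup.dist1_inv, dist1_eq_norm]; exact (frame₂_estimates V hρ hV hδ1 h21 c.src).2.trans (by linarith)
  have f2 : dist1 (corr₂ (federbushSU (n := n)) (expMeanLogSU (n := n)) V c) ≤ 60 * Dn P * η := by
    rw [dist1_eq_norm]; exact (corr₂_estimates V hρ hV hF hδ h2 c).2.trans (by linarith)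
  have f3 : dist1 (axialAvg V c) ≤ η := by
    rw [dist1_eq_norm]; exact (ax_estimates V hρ hV c).2.trans (walkMass_ax_le V hρ hV _ _)
  have f4 : dist1 (frame₂ V c.tgt) ≤ 5 * η := by
    rw [dist1_eq_norm]; exact (frame₂_estimates V hρ hV hδ1 h21 c.tgt).2.trans (by linarith)
  rw [framed₂_apply]
  calc dist1 ((frame₂ V c.src)⁻¹ * corr₂ (federbushSU (n := n)) (expMeanLogSU (n := n)) V c * axialAvg V c * frame₂ V c.tgt)
      ≤ dist1 ((frame₂ V c.src)⁻¹ * corr₂ (federbushSU (n := n)) (expMeanLogSU (n := n)) V c * axialAvg V c)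
        + dist1 (frame₂ V c.tgt) := GaugeGroup.dist1_mul_le _ _
    _ ≤ dist1 ((frame₂ V c.src)⁻¹ * corr₂ (federbushSU (n := n)) (expMeanLogSU (n := n)) V c) + dist1 (axialAvg V c)
        + dist1 (frame₂ V c.tgt) := by gcongr; exact GaugeGroup.dist1_mul_le _ _
    _ ≤ dist1 (frame₂ V c.src)⁻¹ + dist1 (corr₂ (federbushSU (n := n)) (expMeanLogSU (n := n)) V c) + dist1 (axialAvg V c)
        + dist1 (frame₂ V c.tgt) := by gcongr; exact GaugeGroup.dist1_mul_le _ _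
    _ ≤ 71 * Dn P * η := by nlinarith

end SUN

end Summit.QuantumFields.BalabanUV.T4Continuum.Spine.NE7

end
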